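import Mathlib
import Summits.Ventures.PercRepro2.HMFRootEdgeNormChord
import Summits.Ventures.PercRepro2.HMFSwap

/-!
# The normalised chord across the other root edge `{a₃, a₂}` (blind cell PercRepro2, night-1 g18;
NIGHT1-G18.md §2)

The root symmetry `HMFSwap.HMF_root_swap` / `CovForm.HCov_swap` transports the root-edge
reductions of `HMFRootEdgeNormChord` to an edge `f = {a₃, a₂}`: the rows are the rows of the
relabelled instance (`a₁ ↔ a₂`).

* **`HMF_of_root2_edge_of_tangents`**: `0 ≤ ρ₀′ → 0 ≤ ρ₁′ → HMF (p[f ↦ 0]) → HMF p`;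
* **`HCov_of_root2_edge_of_tangents`**: the same for (HCOV).

Own code; standard axioms.
-/

namespace Summit.Ventures.PercRepro2

open UnionCluster CovForm

namespace RootEdge

section Swap

variable {V : Type*} {E : Type*} [Fintype E] [DecidableEq E] [Fintype V] [DecidableEq V]
  {R : Type*} [Field R] [LinearOrder R] [IsStrictOrderedRing R]

variable (p : E → R) (ends : E → Sym2 V) (o : V) {a₁ a₂ a₃ : V} (b : V) {f : E}

/-- **The root edge `{a₃, a₂}` is deletable for (HMF) modulo the two rows of the relabelled
instance.** -/
theorem HMF_of_root2_edge_of_tangents (hp : IsProbVec p) (hf : ends f = s(a₃, a₂))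
    (h0 : 0 ≤ rootTangentZero p ends o a₂ a₁ a₃ b f)
    (h1 : 0 ≤ rootTangentOne p ends o a₂ a₁ a₃ b f)
    (hHMF : HMF (Function.update p f 0) ends o a₁ a₂ a₃ b) : HMF p ends o a₁ a₂ a₃ b := by
  rw [← HMFSwap.HMF_root_swap] at hHMF ⊢
  exact HMF_of_root_edge_of_tangents p ends o b hp hf h0 h1 hHMF

/-- **The root edge `{a₃, a₂}` is deletable for (HCOV) modulo the two rows of the relabelled
instance.** -/
theorem HCov_of_root2_edge_of_tangents (hp : IsProbVec p) (hf : ends f = s(a₃, a₂))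
    (h0 : 0 ≤ rootTangentZero p ends o a₂ a₁ a₃ b f)
    (h1 : 0 ≤ rootTangentOne p ends o a₂ a₁ a₃ b f)
    (hHCov : HCov (Function.update p f 0) ends o a₁ a₂ a₃ b) : HCov p ends o a₁ a₂ a₃ b := by
  rw [← CovForm.HCov_swap] at hHCov ⊢
  exact HCov_of_root_edge_of_tangents p ends o b hp hf h0 h1 hHCov

end Swap

end RootEdge

end Summit.Ventures.PercRepro2
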